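import Mathlib.NumberTheory.LegendreSymbol.QuadraticReciprocity
import Mathlib.NumberTheory.Padics.PadicVal.Basic
import HarnessLib

/-!
# Serre's explicit local Hilbert symbols over `ℚ`: the product formula (arithmetic part)

Topic `NumberTheory/QuadraticForms`; namespace `Literature`. All declarations are definitions with
bodies or fully proved theorems; no `p`-adic numbers occur in this file.

For `a, b ∈ ℚ×` and a place `v` of `ℚ`, Serre (*A Course in Arithmetic*, Ch. III §1.2 Thm. 1)
computes the Hilbert symbol `(a, b)_v ∈ {±1}` explicitly: writing `a = p^α u`, `b = p^β w` with
`p`-adic units `u, w`,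
* `(a, b)_∞ = -1` iff `a, b < 0`;
* `(a, b)_p = (-1)^{α β ε(p)} (u / p)^β (w / p)^α` for `p ≠ 2` (`ε(p) = (p-1)/2`, Legendre
  symbols);
* `(a, b)_2 = (-1)^{ε(u) ε(w) + α ω(w) + β ω(u)}` (`ε(u) = (u-1)/2`, `ω(u) = (u²-1)/8 mod 2`).

This file *defines* these right-hand sides for non-zero **integers** `a, b` —
`localSignInfty a b`, `localSignOdd p a b`, `localSignTwo a b` (with `(-1)^ε = χ₄`,
`(-1)^ω = χ₈`, Mathlib's quadratic characters `ZMod.χ₄`, `ZMod.χ₈`, and `primeCompl p a` the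
prime-to-`p` part of `a`) — and proves the **product formula** for them
(`totalSign_eq_one`): for any finite set `S` of odd primes containing the odd prime divisors of
`a b`,

  `localSignInfty a b * localSignTwo a b * ∏_{p ∈ S} localSignOdd p a b = 1`.

This is exactly Serre's proof of Hilbert's product formula `∏_v (a, b)_v = 1` over `ℚ` (Ch. III
§2.1 Thm. 3): the explicit signs are symmetric and bimultiplicative (`totalSign_mul_left/right`),
which reduces the claim to `a, b ∈ {-1, 2} ∪ {odd primes}` (`int_mul_induction`), where it is
`(-1, -1)_∞ = (-1, -1)_2 = -1`, the two supplements `(-1 / ℓ) = χ₄ ℓ`, `(2 / ℓ) = χ₈ ℓ`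
(Mathlib `legendreSym.at_neg_one`, `legendreSym.at_two`) and quadratic reciprocity
`(ℓ / ℓ')(ℓ' / ℓ) = (-1)^{ε(ℓ) ε(ℓ')}` (Mathlib `legendreSym.quadratic_reciprocity`).

The identification of these signs with the actual Hilbert symbols `hilbertSymbol ℚ_v a b`
(`Literature/NumberTheory/QuadraticForms/HilbertSymbol.lean`; Serre III Thm. 1) is carried out
place by place in the sibling files (`HilbertSymbolArchimedean` for `v = ∞`,
`HilbertSymbolNonDyadic` for odd `p`; the dyadic place is the remaining local computation), after
which `totalSign_eq_one` yields Hilbert reciprocity `hilbertReciprocity ℚ a b`.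

## References

* J.-P. Serre, *A Course in Arithmetic*, GTM 7, Springer (1973), Ch. III §1.2 Thm. 1 (PDF
  p. 20), §2.1 Thm. 3 (PDF p. 23).
-/

namespace Literature.NumberTheory.QuadraticForms

open ZMod

/-! ### The prime-to-`p` part of an integer -/

/-- The prime-to-`p` part `u` of a non-zero integer `a = p^α u`, `α = v_p(a)` (`u = a` for
`a = 0`). [folklore] -/
def primeCompl (p : ℕ) (a : ℤ) : ℤ := a / (p : ℤ) ^ padicValInt p a

/-- `pow_padicValInt_mul_primeCompl`: elementary bookkeeping for Serre's explicit signs (Ch. III Thm. 1 / Thm. 3). [folklore] -/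
theorem pow_padicValInt_mul_primeCompl (p : ℕ) (a : ℤ) :
    (p : ℤ) ^ padicValInt p a * primeCompl p a = a :=
  Int.mul_ediv_cancel' (padicValInt_dvd a)

/-- `primeCompl_ne_zero`: elementary bookkeeping for Serre's explicit signs (Ch. III Thm. 1 / Thm. 3). [folklore] -/
theorem primeCompl_ne_zero {p : ℕ} {a : ℤ} (ha : a ≠ 0) : primeCompl p a ≠ 0 := by
  intro h
  apply ha
  rw [← pow_padicValInt_mul_primeCompl p a, h, mul_zero]

variable {p : ℕ} [hp : Fact p.Prime]

/-- `not_dvd_primeCompl`: elementary bookkeeping for Serre's explicit signs (Ch. III Thm. 1 / Thm. 3). [folklore] -/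
theorem not_dvd_primeCompl {a : ℤ} (ha : a ≠ 0) : ¬ (p : ℤ) ∣ primeCompl p a := by
  intro h
  have h1 : (p : ℤ) ^ (padicValInt p a + 1) ∣ a := by
    have h2 : (p : ℤ) ^ padicValInt p a * (p : ℤ) ∣ (p : ℤ) ^ padicValInt p a * primeCompl p a :=
      mul_dvd_mul_left _ h
    rwa [pow_padicValInt_mul_primeCompl p a, ← pow_succ] at h2
  rw [padicValInt_dvd_iff] at h1
  rcases h1 with h1 | h1
  · exact ha h1
  · omega

/-- Uniqueness of the decomposition `a = p^n u` with `p ∤ u`. [folklore] -/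
theorem padicValInt_eq_of_eq_pow_mul {a u : ℤ} {n : ℕ} (hu : ¬ (p : ℤ) ∣ u) (h : a = (p : ℤ) ^ n * u) :
    padicValInt p a = n ∧ primeCompl p a = u := by
  have hp1 : 1 < p := hp.out.one_lt
  have hu0 : u ≠ 0 := fun h0 ↦ hu (h0 ▸ dvd_zero _)
  have hpn : (p : ℤ) ^ n ≠ 0 := pow_ne_zero _ (by exact_mod_cast hp.out.ne_zero)
  -- `v_p(p^n) = n`
  have hpow : ∀ m : ℕ, padicValInt p ((p : ℤ) ^ m) = m := by
    intro m
    induction m with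
    | zero => simp [padicValInt.one]
    | succ k ih =>
      rw [pow_succ, padicValInt.mul (pow_ne_zero _ (by exact_mod_cast hp.out.ne_zero))
        (by exact_mod_cast hp.out.ne_zero), ih, padicValInt_self]
  have hval : padicValInt p a = n := by
    rw [h, padicValInt.mul hpn hu0, padicValInt.eq_zero_of_not_dvd hu, add_zero, hpow]
  refine ⟨hval, ?_⟩
  unfold primeCompl
  rw [hval, h, Int.mul_ediv_cancel_left _ hpn]

/-- `primeCompl_mul`: elementary bookkeeping for Serre's explicit signs (Ch. III Thm. 1 / Thm. 3). [folklore] -/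
theorem primeCompl_mul {a b : ℤ} (ha : a ≠ 0) (hb : b ≠ 0) :
    primeCompl p (a * b) = primeCompl p a * primeCompl p b := by
  have h : a * b = (p : ℤ) ^ (padicValInt p a + padicValInt p b) *
      (primeCompl p a * primeCompl p b) := by
    conv_lhs => rw [← pow_padicValInt_mul_primeCompl p a, ← pow_padicValInt_mul_primeCompl p b]
    ring
  refine (padicValInt_eq_of_eq_pow_mul (p := p) ?_ h).2
  exact fun hd ↦ ((Int.Prime.dvd_mul' hp.out hd).elim (not_dvd_primeCompl ha))
    (not_dvd_primeCompl hb)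

/-- `padicValInt_mul'`: elementary bookkeeping for Serre's explicit signs (Ch. III Thm. 1 / Thm. 3). [folklore] -/
theorem padicValInt_mul' {a b : ℤ} (ha : a ≠ 0) (hb : b ≠ 0) :
    padicValInt p (a * b) = padicValInt p a + padicValInt p b := padicValInt.mul ha hb

omit hp in
/-- `primeCompl_one`: elementary bookkeeping for Serre's explicit signs (Ch. III Thm. 1 / Thm. 3). [folklore] -/
@[simp] theorem primeCompl_one : primeCompl p 1 = 1 := by
  simp [primeCompl, padicValInt.one]

/-- `primeCompl_neg_one`: elementary bookkeeping for Serre's explicit signs (Ch. III Thm. 1 / Thm. 3). [folklore] -/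
@[simp] theorem primeCompl_neg_one : primeCompl p (-1) = -1 := by
  have := (padicValInt_eq_of_eq_pow_mul (p := p) (a := -1) (u := -1) (n := 0) ?_ (by simp)).2
  · exact this
  · rw [dvd_neg]
    exact_mod_cast hp.out.not_dvd_one

omit hp in
/-- `padicValInt_neg_one`: elementary bookkeeping for Serre's explicit signs (Ch. III Thm. 1 / Thm. 3). [folklore] -/
@[simp] theorem padicValInt_neg_one : padicValInt p (-1) = 0 := by
  rw [padicValInt, Int.natAbs_neg, Int.natAbs_one, padicValNat_one_right]

/-- `primeCompl_self`: elementary bookkeeping for Serre's explicit signs (Ch. III Thm. 1 / Thm. 3). [folklore] -/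
theorem primeCompl_self : primeCompl p p = 1 :=
  (padicValInt_eq_of_eq_pow_mul (p := p) (a := p) (u := 1) (n := 1)
    (by exact_mod_cast hp.out.not_dvd_one) (by simp)).2

/-- `primeCompl_of_not_dvd`: elementary bookkeeping for Serre's explicit signs (Ch. III Thm. 1 / Thm. 3). [folklore] -/
theorem primeCompl_of_not_dvd {a : ℤ} (h : ¬ (p : ℤ) ∣ a) : primeCompl p a = a :=
  (padicValInt_eq_of_eq_pow_mul (p := p) (n := 0) h (by simp)).2

omit hp in
/-- `padicValInt_of_not_dvd`: elementary bookkeeping for Serre's explicit signs (Ch. III Thm. 1 / Thm. 3). [folklore] -/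
theorem padicValInt_of_not_dvd {a : ℤ} (h : ¬ (p : ℤ) ∣ a) : padicValInt p a = 0 :=
  padicValInt.eq_zero_of_not_dvd h

/-! ### Serre's explicit local signs -/

omit hp in
/-- For odd `u`, `χ₄ u = ±1`. [folklore] -/
theorem χ₄_eq_one_or_of_odd {u : ℤ} (hu : Odd u) :
    χ₄ (u : ZMod 4) = 1 ∨ χ₄ (u : ZMod 4) = -1 := by
  rw [χ₄_int_eq_if_mod_four]
  have : u % 2 = 1 := Int.odd_iff.1 hu
  split_ifs <;> simp_all

omit hp in
/-- For odd `u`, `χ₈ u = ±1`. [folklore] -/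
theorem χ₈_eq_one_or_of_odd {u : ℤ} (hu : Odd u) :
    χ₈ (u : ZMod 8) = 1 ∨ χ₈ (u : ZMod 8) = -1 := by
  rw [χ₈_int_eq_if_mod_eight]
  have : u % 2 = 1 := Int.odd_iff.1 hu
  split_ifs <;> simp_all

omit hp in
/-- The prime-to-`2` part of a non-zero integer is odd. [folklore] -/
theorem odd_primeCompl_two {a : ℤ} (ha : a ≠ 0) : Odd (primeCompl 2 a) := by
  haveI : Fact (Nat.Prime 2) := ⟨Nat.prime_two⟩
  rw [← Int.not_even_iff_odd, even_iff_two_dvd]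
  exact_mod_cast not_dvd_primeCompl (p := 2) ha

/-- The sign factor `(-1)^{ε(u) ε(w)}` of Serre's dyadic formula, written with `χ₄`
(`χ₄ u = (-1)^{ε(u)}` for odd `u`). [cite: Serre1973, Ch. III §1.2 Thm. 1] -/
def epsSign (u w : ℤ) : ℤ := if χ₄ (u : ZMod 4) = -1 ∧ χ₄ (w : ZMod 4) = -1 then -1 else 1

omit hp in
/-- `epsSign_comm`: elementary bookkeeping for Serre's explicit signs (Ch. III Thm. 1 / Thm. 3). [folklore] -/
theorem epsSign_comm (u w : ℤ) : epsSign u w = epsSign w u := by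
  unfold epsSign; simp only [and_comm]

omit hp in
/-- `epsSign_mul_left`: elementary bookkeeping for Serre's explicit signs (Ch. III Thm. 1 / Thm. 3). [folklore] -/
theorem epsSign_mul_left {u u' w : ℤ} (hu : Odd u) (hu' : Odd u') (hw : Odd w) :
    epsSign (u * u') w = epsSign u w * epsSign u' w := by
  unfold epsSign
  rw [Int.cast_mul, map_mul]
  rcases χ₄_eq_one_or_of_odd hu with h1 | h1 <;> rcases χ₄_eq_one_or_of_odd hu' with h2 | h2 <;>
    rcases χ₄_eq_one_or_of_odd hw with h3 | h3 <;> simp [h1, h2, h3]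

/-- **Serre's local sign at an odd prime `p`**: for `a = p^α u`, `b = p^β w` with `p ∤ u w`,
`(a, b)_p = (-1)^{α β ε(p)} (u / p)^β (w / p)^α` (Serre, *A Course in Arithmetic*, Ch. III
Thm. 1; `(-1)^{ε(p)} = χ₄ p`). Defined for every `p` (value `1` if `p` is not prime) so that it
can be used inside finite products over sets of primes. [cite: Serre1973, Ch. III §1.2 Thm. 1] -/
def localSignOdd (p : ℕ) (a b : ℤ) : ℤ :=
  if hp : p.Prime then
    haveI := Fact.mk hp
    χ₄ (p : ZMod 4) ^ (padicValInt p a * padicValInt p b) *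
      legendreSym p (primeCompl p a) ^ padicValInt p b *
        legendreSym p (primeCompl p b) ^ padicValInt p a
  else 1

/-- `localSignOdd_def`: elementary bookkeeping for Serre's explicit signs (Ch. III Thm. 1 / Thm. 3). [folklore] -/
theorem localSignOdd_def (a b : ℤ) : localSignOdd p a b =
    χ₄ (p : ZMod 4) ^ (padicValInt p a * padicValInt p b) *
      legendreSym p (primeCompl p a) ^ padicValInt p b *
        legendreSym p (primeCompl p b) ^ padicValInt p a := by
  unfold localSignOdd
  rw [dif_pos hp.out]

/-- **Serre's local sign at `2`**: for `a = 2^α u`, `b = 2^β w` with `u w` odd,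
`(a, b)_2 = (-1)^{ε(u) ε(w) + α ω(w) + β ω(u)}` (Serre Ch. III Thm. 1; `(-1)^{ω(u)} = χ₈ u`).
[cite: Serre1973, Ch. III §1.2 Thm. 1] -/
def localSignTwo (a b : ℤ) : ℤ :=
  epsSign (primeCompl 2 a) (primeCompl 2 b) *
    χ₈ (primeCompl 2 b : ZMod 8) ^ padicValInt 2 a * χ₈ (primeCompl 2 a : ZMod 8) ^ padicValInt 2 b

/-- **The sign at infinity**: `(a, b)_∞ = -1` iff `a, b < 0` (Serre Ch. III Thm. 1, `k = ℝ`).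
[cite: Serre1973, Ch. III §1.2 Thm. 1] -/
def localSignInfty (a b : ℤ) : ℤ := if a < 0 ∧ b < 0 then -1 else 1

/-! ### Symmetry and bimultiplicativity -/

/-- The explicit sign at an odd prime is symmetric: `(a, b)_p = (b, a)_p`. [folklore] -/
theorem localSignOdd_comm (a b : ℤ) : localSignOdd p a b = localSignOdd p b a := by
  rw [localSignOdd_def, localSignOdd_def, mul_comm (padicValInt p a)]
  ring

omit hp in
/-- `localSignTwo_comm`: elementary bookkeeping for Serre's explicit signs (Ch. III Thm. 1 / Thm. 3). [folklore] -/
theorem localSignTwo_comm (a b : ℤ) : localSignTwo a b = localSignTwo b a := by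
  unfold localSignTwo
  rw [epsSign_comm]
  ring

omit hp in
/-- `localSignInfty_comm`: elementary bookkeeping for Serre's explicit signs (Ch. III Thm. 1 / Thm. 3). [folklore] -/
theorem localSignInfty_comm (a b : ℤ) : localSignInfty a b = localSignInfty b a := by
  unfold localSignInfty; simp only [and_comm]

/-- `localSignOdd_mul_left`: elementary bookkeeping for Serre's explicit signs (Ch. III Thm. 1 / Thm. 3). [folklore] -/
theorem localSignOdd_mul_left {a a' : ℤ} (ha : a ≠ 0) (ha' : a' ≠ 0) (b : ℤ) :
    localSignOdd p (a * a') b = localSignOdd p a b * localSignOdd p a' b := by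
  simp only [localSignOdd_def, padicValInt.mul ha ha', primeCompl_mul ha ha', legendreSym.mul,
    add_mul, pow_add, mul_pow]
  ring

omit hp in
/-- `localSignTwo_mul_left`: elementary bookkeeping for Serre's explicit signs (Ch. III Thm. 1 / Thm. 3). [folklore] -/
theorem localSignTwo_mul_left {a a' : ℤ} (ha : a ≠ 0) (ha' : a' ≠ 0) {b : ℤ} (hb : b ≠ 0) :
    localSignTwo (a * a') b = localSignTwo a b * localSignTwo a' b := by
  haveI : Fact (Nat.Prime 2) := ⟨Nat.prime_two⟩
  unfold localSignTwo
  rw [padicValInt.mul ha ha', primeCompl_mul ha ha',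
    epsSign_mul_left (odd_primeCompl_two ha) (odd_primeCompl_two ha') (odd_primeCompl_two hb),
    Int.cast_mul, map_mul, pow_add, mul_pow]
  ring

omit hp in
/-- `localSignInfty_mul_left`: elementary bookkeeping for Serre's explicit signs (Ch. III Thm. 1 / Thm. 3). [folklore] -/
theorem localSignInfty_mul_left {a a' : ℤ} (ha : a ≠ 0) (ha' : a' ≠ 0) (b : ℤ) :
    localSignInfty (a * a') b = localSignInfty a b * localSignInfty a' b := by
  unfold localSignInfty
  by_cases h3 : b < 0
  · rcases lt_or_gt_of_ne ha with h1 | h1 <;> rcases lt_or_gt_of_ne ha' with h2 | h2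
    · have h12 : ¬ a * a' < 0 := not_lt.2 (mul_pos_of_neg_of_neg h1 h2).le
      simp [h1, h2, h3, h12]
    · have h12 : a * a' < 0 := mul_neg_of_neg_of_pos h1 h2
      have h2' : ¬ a' < 0 := not_lt.2 h2.le
      simp [h1, h3, h12, h2']
    · have h12 : a * a' < 0 := mul_neg_of_pos_of_neg h1 h2
      have h1' : ¬ a < 0 := not_lt.2 h1.le
      simp [h2, h3, h12, h1']
    · have h12 : ¬ a * a' < 0 := not_lt.2 (mul_pos h1 h2).le
      have h1' : ¬ a < 0 := not_lt.2 h1.le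
      have h2' : ¬ a' < 0 := not_lt.2 h2.le
      simp [h3, h12, h1', h2']
  · simp [h3]

/-! ### The total sign over a finite set of odd primes -/

/-- The total sign `F_S(a, b) = (a, b)_∞ (a, b)_2 ∏_{p ∈ S} (a, b)_p` of the explicit signs over
a finite set `S` of (odd) primes. [folklore] -/
def totalSign (S : Finset ℕ) (a b : ℤ) : ℤ :=
  localSignInfty a b * localSignTwo a b * ∏ q ∈ S, localSignOdd q a b

omit hp in
/-- `totalSign_comm`: elementary bookkeeping for Serre's explicit signs (Ch. III Thm. 1 / Thm. 3). [folklore] -/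
theorem totalSign_comm (S : Finset ℕ) (a b : ℤ) : totalSign S a b = totalSign S b a := by
  unfold totalSign
  rw [localSignInfty_comm, localSignTwo_comm]
  congr 1
  refine Finset.prod_congr rfl fun q hq ↦ ?_
  by_cases hq' : q.Prime
  · haveI := Fact.mk hq'
    exact localSignOdd_comm a b
  · simp [localSignOdd, hq']

omit hp in
/-- `totalSign_mul_left`: elementary bookkeeping for Serre's explicit signs (Ch. III Thm. 1 / Thm. 3). [folklore] -/
theorem totalSign_mul_left (S : Finset ℕ) {a a' b : ℤ} (ha : a ≠ 0) (ha' : a' ≠ 0) (hb : b ≠ 0) :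
    totalSign S (a * a') b = totalSign S a b * totalSign S a' b := by
  unfold totalSign
  rw [localSignInfty_mul_left ha ha', localSignTwo_mul_left ha ha' hb]
  have : ∏ q ∈ S, localSignOdd q (a * a') b =
      (∏ q ∈ S, localSignOdd q a b) * ∏ q ∈ S, localSignOdd q a' b := by
    rw [← Finset.prod_mul_distrib]
    refine Finset.prod_congr rfl fun q hq ↦ ?_
    by_cases hq' : q.Prime
    · haveI := Fact.mk hq'
      exact localSignOdd_mul_left ha ha' b
    · simp [localSignOdd, hq']
  rw [this]
  ring

omit hp in
/-- `totalSign_mul_right`: elementary bookkeeping for Serre's explicit signs (Ch. III Thm. 1 / Thm. 3). [folklore] -/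
theorem totalSign_mul_right (S : Finset ℕ) {a b b' : ℤ} (ha : a ≠ 0) (hb : b ≠ 0) (hb' : b' ≠ 0) :
    totalSign S a (b * b') = totalSign S a b * totalSign S a b' := by
  rw [totalSign_comm, totalSign_mul_left S hb hb' ha, totalSign_comm S b, totalSign_comm S b']

/-! ### Values of the local signs at the generators `-1`, `2`, odd primes -/

/-- `(a, b)_p = 1` (explicit sign) when `p ∤ a` and `p ∤ b` (`α = β = 0`; Serre III Thm. 1).
[folklore] -/
theorem localSignOdd_of_not_dvd {a b : ℤ} (ha : ¬ (p : ℤ) ∣ a) (hb : ¬ (p : ℤ) ∣ b) :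
    localSignOdd p a b = 1 := by
  rw [localSignOdd_def, padicValInt_of_not_dvd ha, padicValInt_of_not_dvd hb]
  simp

/-- `(a, p)_p = (a / p)` for `p ∤ a` (explicit sign; Serre III Thm. 1 with `α = 0`, `β = 1`).
[folklore] -/
theorem localSignOdd_self_right {a : ℤ} (ha : ¬ (p : ℤ) ∣ a) :
    localSignOdd p a p = legendreSym p a := by
  rw [localSignOdd_def, padicValInt_of_not_dvd ha, primeCompl_of_not_dvd ha, padicValInt_self,
    primeCompl_self]
  simp

/-- `(p, p)_p = (-1)^{ε(p)} = χ₄ p` (explicit sign; Serre III Thm. 1 with `α = β = 1`).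
[folklore] -/
theorem localSignOdd_self_self : localSignOdd p p p = χ₄ (p : ZMod 4) := by
  rw [localSignOdd_def, padicValInt_self, primeCompl_self]
  simp

omit hp in
/-- `fact2`: elementary bookkeeping for Serre's explicit signs (Ch. III Thm. 1 / Thm. 3). [folklore] -/
private theorem fact2 : Fact (Nat.Prime 2) := ⟨Nat.prime_two⟩

attribute [local instance] fact2 in
omit hp in
/-- `localSignTwo_of_odd`: elementary bookkeeping for Serre's explicit signs (Ch. III Thm. 1 / Thm. 3). [folklore] -/
theorem localSignTwo_of_odd {a b : ℤ} (ha : ¬ (2 : ℤ) ∣ a) (hb : ¬ (2 : ℤ) ∣ b) :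
    localSignTwo a b = epsSign a b := by
  unfold localSignTwo
  rw [padicValInt_of_not_dvd (p := 2) (by exact_mod_cast ha),
    padicValInt_of_not_dvd (p := 2) (by exact_mod_cast hb),
    primeCompl_of_not_dvd (p := 2) (by exact_mod_cast ha),
    primeCompl_of_not_dvd (p := 2) (by exact_mod_cast hb)]
  simp

attribute [local instance] fact2 in
omit hp in
/-- `localSignTwo_two_left`: elementary bookkeeping for Serre's explicit signs (Ch. III Thm. 1 / Thm. 3). [folklore] -/
theorem localSignTwo_two_left {b : ℤ} (hb : ¬ (2 : ℤ) ∣ b) :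
    localSignTwo 2 b = χ₈ (b : ZMod 8) := by
  unfold localSignTwo
  have h1 : padicValInt 2 (2 : ℤ) = 1 := by exact_mod_cast padicValInt_self (p := 2)
  have h2 : primeCompl 2 (2 : ℤ) = 1 := by exact_mod_cast primeCompl_self (p := 2)
  rw [h1, h2, padicValInt_of_not_dvd (p := 2) (by exact_mod_cast hb),
    primeCompl_of_not_dvd (p := 2) (by exact_mod_cast hb)]
  simp [epsSign]

attribute [local instance] fact2 in
omit hp in
/-- `localSignTwo_two_two`: elementary bookkeeping for Serre's explicit signs (Ch. III Thm. 1 / Thm. 3). [folklore] -/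
theorem localSignTwo_two_two : localSignTwo 2 2 = 1 := by
  unfold localSignTwo
  have h1 : padicValInt 2 (2 : ℤ) = 1 := by exact_mod_cast padicValInt_self (p := 2)
  have h2 : primeCompl 2 (2 : ℤ) = 1 := by exact_mod_cast primeCompl_self (p := 2)
  rw [h1, h2]
  simp [epsSign]

omit hp in
/-- `epsSign_neg_one_left`: elementary bookkeeping for Serre's explicit signs (Ch. III Thm. 1 / Thm. 3). [folklore] -/
theorem epsSign_neg_one_left (w : ℤ) : epsSign (-1) w = if χ₄ (w : ZMod 4) = -1 then -1 else 1 := by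
  unfold epsSign
  have : χ₄ ((-1 : ℤ) : ZMod 4) = -1 := by decide
  simp only [this, true_and]

omit hp in
/-- `epsSign_one_left`: elementary bookkeeping for Serre's explicit signs (Ch. III Thm. 1 / Thm. 3). [folklore] -/
theorem epsSign_one_left (w : ℤ) : epsSign 1 w = 1 := by
  unfold epsSign
  rw [Int.cast_one, map_one, if_neg]
  rintro ⟨h, -⟩
  norm_num at h

omit hp in
/-- For odd `w`, `(if χ₄ w = -1 then -1 else 1) = χ₄ w`. [folklore] -/
theorem ite_χ₄_eq {w : ℤ} (hw : Odd w) : (if χ₄ (w : ZMod 4) = -1 then -1 else 1) = χ₄ (w : ZMod 4) := by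
  rcases χ₄_eq_one_or_of_odd hw with h | h <;> simp [h]

omit hp in
/-- `localSignInfty_of_pos_left`: elementary bookkeeping for Serre's explicit signs (Ch. III Thm. 1 / Thm. 3). [folklore] -/
theorem localSignInfty_of_pos_left {a : ℤ} (ha : 0 < a) (b : ℤ) : localSignInfty a b = 1 := by
  unfold localSignInfty
  simp [not_lt.2 ha.le]

omit hp in
/-- `localSignInfty_of_pos_right`: elementary bookkeeping for Serre's explicit signs (Ch. III Thm. 1 / Thm. 3). [folklore] -/
theorem localSignInfty_of_pos_right (a : ℤ) {b : ℤ} (hb : 0 < b) : localSignInfty a b = 1 := by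
  rw [localSignInfty_comm]; exact localSignInfty_of_pos_left hb a

omit hp in
/-- `localSignInfty_neg_one_neg_one`: elementary bookkeeping for Serre's explicit signs (Ch. III Thm. 1 / Thm. 3). [folklore] -/
theorem localSignInfty_neg_one_neg_one : localSignInfty (-1) (-1) = -1 := by
  unfold localSignInfty; simp

omit hp in
/-- `χ₄ u · χ₄ u = 1` for odd `u`. [folklore] -/
theorem χ₄_mul_self_of_odd {u : ℤ} (hu : Odd u) : χ₄ (u : ZMod 4) * χ₄ (u : ZMod 4) = 1 := by
  rcases χ₄_eq_one_or_of_odd hu with h | h <;> simp [h]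

omit hp in
/-- `χ₈_mul_self_of_odd`: elementary bookkeeping for Serre's explicit signs (Ch. III Thm. 1 / Thm. 3). [folklore] -/
theorem χ₈_mul_self_of_odd {u : ℤ} (hu : Odd u) : χ₈ (u : ZMod 8) * χ₈ (u : ZMod 8) = 1 := by
  rcases χ₈_eq_one_or_of_odd hu with h | h <;> simp [h]

omit hp in
/-- `(-1)^{ε(m) ε(n)} = (-1)^{(m/2)(n/2)}` for odd naturals `m, n` (`χ₄ m = (-1)^{m/2}`, Mathlib
`ZMod.χ₄_eq_neg_one_pow`). [folklore] -/
theorem epsSign_natCast_eq {m n : ℕ} (hm : m % 2 = 1) (hn : n % 2 = 1) :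
    epsSign m n = (-1) ^ (m / 2 * (n / 2)) := by
  unfold epsSign
  rw [Int.cast_natCast, Int.cast_natCast, χ₄_eq_neg_one_pow hm, χ₄_eq_neg_one_pow hn]
  rcases Nat.even_or_odd (m / 2) with h1 | h1 <;> rcases Nat.even_or_odd (n / 2) with h2 | h2
  · simp [h1.neg_one_pow, (h1.mul_right _).neg_one_pow]
  · simp [h1.neg_one_pow, (h1.mul_right _).neg_one_pow]
  · simp [h2.neg_one_pow, (h2.mul_left _).neg_one_pow]
  · simp [h1.neg_one_pow, h2.neg_one_pow, (h1.mul h2).neg_one_pow]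

/-! ### The total sign at pairs of generators -/

section Generators

variable (S : Finset ℕ)

omit hp in
/-- `totalSign_one_left`: elementary bookkeeping for Serre's explicit signs (Ch. III Thm. 1 / Thm. 3). [folklore] -/
theorem totalSign_one_left (b : ℤ) : totalSign S 1 b = 1 := by
  haveI : Fact (Nat.Prime 2) := ⟨Nat.prime_two⟩
  unfold totalSign
  rw [localSignInfty_of_pos_left one_pos]
  have h2 : localSignTwo 1 b = 1 := by
    unfold localSignTwo
    rw [primeCompl_one, padicValInt.one, epsSign_one_left]
    simp
  rw [h2]
  have h3 : ∏ q ∈ S, localSignOdd q 1 b = 1 := by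
    refine Finset.prod_eq_one fun q hq ↦ ?_
    by_cases hq' : q.Prime
    · haveI := Fact.mk hq'
      rw [localSignOdd_def, primeCompl_one, padicValInt.one]
      simp [legendreSym.at_one]
    · simp [localSignOdd, hq']
  rw [h3]; ring

omit hp in
/-- `totalSign_one_right`: elementary bookkeeping for Serre's explicit signs (Ch. III Thm. 1 / Thm. 3). [folklore] -/
theorem totalSign_one_right (a : ℤ) : totalSign S a 1 = 1 := by
  rw [totalSign_comm]; exact totalSign_one_left S a

variable (hS : ∀ q ∈ S, q.Prime ∧ q ≠ 2)
include hS

omit hp in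
/-- The odd-prime factor of the total sign is `1` when no prime of `S` divides `a` or `b`.
[folklore] -/
theorem prod_localSignOdd_eq_one {a b : ℤ} (h : ∀ q ∈ S, ¬ (q : ℤ) ∣ a ∧ ¬ (q : ℤ) ∣ b) :
    ∏ q ∈ S, localSignOdd q a b = 1 := by
  refine Finset.prod_eq_one fun q hq ↦ ?_
  haveI := Fact.mk (hS q hq).1
  exact localSignOdd_of_not_dvd (h q hq).1 (h q hq).2

omit hp in
/-- `not_dvd_neg_one_of_mem`: elementary bookkeeping for Serre's explicit signs (Ch. III Thm. 1 / Thm. 3). [folklore] -/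
theorem not_dvd_neg_one_of_mem {q : ℕ} (hq : q ∈ S) : ¬ (q : ℤ) ∣ -1 := by
  rw [dvd_neg]; exact_mod_cast (hS q hq).1.not_dvd_one

omit hp in
/-- `not_dvd_two_of_mem`: elementary bookkeeping for Serre's explicit signs (Ch. III Thm. 1 / Thm. 3). [folklore] -/
theorem not_dvd_two_of_mem {q : ℕ} (hq : q ∈ S) : ¬ (q : ℤ) ∣ 2 := by
  intro h
  have h' : q ∣ 2 := by exact_mod_cast h
  rcases (Nat.dvd_prime Nat.prime_two).1 h' with h1 | h1
  · exact (hS q hq).1.ne_one h1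
  · exact (hS q hq).2 h1

omit hp in
/-- `not_dvd_prime_of_mem_of_ne`: elementary bookkeeping for Serre's explicit signs (Ch. III Thm. 1 / Thm. 3). [folklore] -/
theorem not_dvd_prime_of_mem_of_ne {q ℓ : ℕ} (hq : q ∈ S) (hℓ : ℓ.Prime) (hne : q ≠ ℓ) :
    ¬ (q : ℤ) ∣ ℓ := by
  intro h
  have h' : q ∣ ℓ := by exact_mod_cast h
  exact hne ((Nat.prime_dvd_prime_iff_eq (hS q hq).1 hℓ).1 h')

omit hp in
/-- `F_S(-1, -1) = 1`: `(-1,-1)_∞ = (-1,-1)_2 = -1`, all odd `p` give `1` (Serre III Thm. 3,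
case 1). [folklore] -/
theorem totalSign_neg_one_neg_one : totalSign S (-1) (-1) = 1 := by
  unfold totalSign
  rw [localSignInfty_neg_one_neg_one, localSignTwo_of_odd (by decide) (by decide),
    epsSign_neg_one_left, prod_localSignOdd_eq_one S hS fun q hq ↦
      ⟨not_dvd_neg_one_of_mem S hS hq, not_dvd_neg_one_of_mem S hS hq⟩]
  decide

omit hp in
/-- `F_S(-1, 2) = 1`: all local signs are `1` (`χ₈(-1) = 1`; Serre III Thm. 3, case 2 with
`l = 2`). [folklore] -/
theorem totalSign_neg_one_two : totalSign S (-1) 2 = 1 := by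
  unfold totalSign
  rw [localSignInfty_of_pos_right _ two_pos, localSignTwo_comm, localSignTwo_two_left (by decide),
    prod_localSignOdd_eq_one S hS fun q hq ↦
      ⟨not_dvd_neg_one_of_mem S hS hq, not_dvd_two_of_mem S hS hq⟩]
  decide

omit hp in
/-- `totalSign_two_two`: elementary bookkeeping for Serre's explicit signs (Ch. III Thm. 1 / Thm. 3). [folklore] -/
theorem totalSign_two_two : totalSign S 2 2 = 1 := by
  unfold totalSign
  rw [localSignInfty_of_pos_right _ two_pos, localSignTwo_two_two,
    prod_localSignOdd_eq_one S hS fun q hq ↦ ⟨not_dvd_two_of_mem S hS hq, not_dvd_two_of_mem S hS hq⟩]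
  simp

omit hp in
/-- `odd_of_mem`: elementary bookkeeping for Serre's explicit signs (Ch. III Thm. 1 / Thm. 3). [folklore] -/
theorem odd_of_mem {ℓ : ℕ} (hℓ : ℓ ∈ S) : Odd (ℓ : ℤ) := by
  rw [Int.odd_coe_nat]
  exact (hS ℓ hℓ).1.odd_of_ne_two (hS ℓ hℓ).2

omit hp in
/-- `F_S(-1, ℓ) = 1` for an odd prime `ℓ ∈ S`: `(-1, ℓ)_2 = χ₄ ℓ = (-1 / ℓ) = (-1, ℓ)_ℓ` (first
supplement, Mathlib `legendreSym.at_neg_one`; Serre III Thm. 3, case 2). [folklore] -/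
theorem totalSign_neg_one_prime {ℓ : ℕ} (hℓ : ℓ ∈ S) : totalSign S (-1) ℓ = 1 := by
  haveI := Fact.mk (hS ℓ hℓ).1
  have hℓ2 : ℓ ≠ 2 := (hS ℓ hℓ).2
  have hodd := odd_of_mem S hS hℓ
  have hℓodd : ¬ (2 : ℤ) ∣ (ℓ : ℤ) := by
    rw [← even_iff_two_dvd, ← Int.not_odd_iff_even, not_not]; exact hodd
  unfold totalSign
  rw [localSignInfty_of_pos_right _ (by exact_mod_cast (hS ℓ hℓ).1.pos),
    localSignTwo_of_odd (by decide) hℓodd, epsSign_neg_one_left, ite_χ₄_eq hodd,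
    Finset.prod_eq_single_of_mem ℓ hℓ fun q hq hne ↦ ?_]
  · rw [localSignOdd_self_right (not_dvd_neg_one_of_mem S hS hℓ), legendreSym.at_neg_one hℓ2,
      Int.cast_natCast, one_mul]
    exact χ₄_mul_self_of_odd hodd
  · haveI := Fact.mk (hS q hq).1
    exact localSignOdd_of_not_dvd (not_dvd_neg_one_of_mem S hS hq)
      (not_dvd_prime_of_mem_of_ne S hS hq (hS ℓ hℓ).1 hne)

omit hp in
/-- `F_S(2, ℓ) = 1` for an odd prime `ℓ ∈ S`: `(2, ℓ)_2 = χ₈ ℓ = (2 / ℓ) = (2, ℓ)_ℓ` (second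
supplement, Mathlib `legendreSym.at_two`; Serre III Thm. 3, case 3 with `l' = 2`). [folklore] -/
theorem totalSign_two_prime {ℓ : ℕ} (hℓ : ℓ ∈ S) : totalSign S 2 ℓ = 1 := by
  haveI := Fact.mk (hS ℓ hℓ).1
  have hℓ2 : ℓ ≠ 2 := (hS ℓ hℓ).2
  have hodd := odd_of_mem S hS hℓ
  have hℓodd : ¬ (2 : ℤ) ∣ (ℓ : ℤ) := by
    rw [← even_iff_two_dvd, ← Int.not_odd_iff_even, not_not]; exact hodd
  unfold totalSign
  rw [localSignInfty_of_pos_left two_pos, localSignTwo_two_left hℓodd,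
    Finset.prod_eq_single_of_mem ℓ hℓ fun q hq hne ↦ ?_]
  · rw [localSignOdd_self_right (not_dvd_two_of_mem S hS hℓ), legendreSym.at_two hℓ2,
      Int.cast_natCast, one_mul]
    exact χ₈_mul_self_of_odd hodd
  · haveI := Fact.mk (hS q hq).1
    exact localSignOdd_of_not_dvd (not_dvd_two_of_mem S hS hq)
      (not_dvd_prime_of_mem_of_ne S hS hq (hS ℓ hℓ).1 hne)

omit hp in
/-- `F_S(ℓ, ℓ) = 1` for an odd prime `ℓ ∈ S`: `(ℓ, ℓ)_2 = χ₄ ℓ = (ℓ, ℓ)_ℓ` (Serre III Thm. 3, case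
3 with `l = l'`). [folklore] -/
theorem totalSign_prime_self {ℓ : ℕ} (hℓ : ℓ ∈ S) : totalSign S ℓ ℓ = 1 := by
  haveI := Fact.mk (hS ℓ hℓ).1
  have hodd := odd_of_mem S hS hℓ
  have hℓodd : ¬ (2 : ℤ) ∣ (ℓ : ℤ) := by
    rw [← even_iff_two_dvd, ← Int.not_odd_iff_even, not_not]; exact hodd
  unfold totalSign
  rw [localSignInfty_of_pos_left (by exact_mod_cast (hS ℓ hℓ).1.pos), localSignTwo_of_odd hℓodd hℓodd,
    Finset.prod_eq_single_of_mem ℓ hℓ fun q hq hne ↦ ?_]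
  · rw [localSignOdd_self_self, one_mul]
    unfold epsSign
    simp only [and_self]
    rw [ite_χ₄_eq hodd, Int.cast_natCast]
    exact_mod_cast χ₄_mul_self_of_odd hodd
  · haveI := Fact.mk (hS q hq).1
    have h := not_dvd_prime_of_mem_of_ne S hS hq (hS ℓ hℓ).1 hne
    exact localSignOdd_of_not_dvd h h

omit hp in
/-- `F_S(ℓ, ℓ') = 1` for distinct odd primes in `S`: `(ℓ, ℓ')_2 = (-1)^{ε(ℓ)ε(ℓ')}`,
`(ℓ, ℓ')_ℓ = (ℓ' / ℓ)`, `(ℓ, ℓ')_ℓ' = (ℓ / ℓ')`, and quadratic reciprocity (Mathlib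
`legendreSym.quadratic_reciprocity`; Serre III Thm. 3, case 3). [folklore] -/
theorem totalSign_prime_prime {ℓ ℓ' : ℕ} (hℓ : ℓ ∈ S) (hℓ' : ℓ' ∈ S) (hne : ℓ ≠ ℓ') :
    totalSign S ℓ ℓ' = 1 := by
  haveI := Fact.mk (hS ℓ hℓ).1
  haveI := Fact.mk (hS ℓ' hℓ').1
  have hℓ2 : ℓ ≠ 2 := (hS ℓ hℓ).2
  have hℓ'2 : ℓ' ≠ 2 := (hS ℓ' hℓ').2
  have hoddℓ : ¬ (2 : ℤ) ∣ (ℓ : ℤ) := by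
    rw [← even_iff_two_dvd, ← Int.not_odd_iff_even, not_not]; exact odd_of_mem S hS hℓ
  have hoddℓ' : ¬ (2 : ℤ) ∣ (ℓ' : ℤ) := by
    rw [← even_iff_two_dvd, ← Int.not_odd_iff_even, not_not]; exact odd_of_mem S hS hℓ'
  have hnd : ¬ (ℓ : ℤ) ∣ ℓ' := not_dvd_prime_of_mem_of_ne S hS hℓ (hS ℓ' hℓ').1 hne
  have hnd' : ¬ (ℓ' : ℤ) ∣ ℓ := not_dvd_prime_of_mem_of_ne S hS hℓ' (hS ℓ hℓ).1 hne.symm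
  unfold totalSign
  rw [localSignInfty_of_pos_left (by exact_mod_cast (hS ℓ hℓ).1.pos), localSignTwo_of_odd hoddℓ hoddℓ',
    one_mul, Finset.prod_eq_mul_prod_sdiff_singleton_of_mem hℓ,
    Finset.prod_eq_mul_prod_sdiff_singleton_of_mem (Finset.mem_sdiff.2 ⟨hℓ', by simpa using hne.symm⟩),
    Finset.prod_eq_one fun q hq ↦ ?_]
  · -- `epsSign ℓ ℓ' * ((ℓ, ℓ')_ℓ * (ℓ, ℓ')_ℓ') = 1` by quadratic reciprocity
    rw [localSignOdd_comm (p := ℓ), localSignOdd_self_right hnd', localSignOdd_self_right hnd,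
      mul_one, epsSign_natCast_eq (Nat.odd_iff.1 ((hS ℓ hℓ).1.odd_of_ne_two hℓ2))
        (Nat.odd_iff.1 ((hS ℓ' hℓ').1.odd_of_ne_two hℓ'2)),
      legendreSym.quadratic_reciprocity hℓ'2 hℓ2 hne.symm, ← pow_add, mul_comm (ℓ' / 2), ← two_mul]
    exact Even.neg_one_pow (even_two_mul _)
  · simp only [Finset.mem_sdiff, Finset.mem_singleton] at hq
    haveI := Fact.mk (hS q hq.1.1).1
    exact localSignOdd_of_not_dvd (not_dvd_prime_of_mem_of_ne S hS hq.1.1 (hS ℓ hℓ).1 hq.1.2)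
      (not_dvd_prime_of_mem_of_ne S hS hq.1.1 (hS ℓ' hℓ').1 hq.2)

end Generators

/-! ### Multiplicative induction and the product formula for the explicit signs -/

section Main

variable (S : Finset ℕ)

omit hp in
/-- Multiplicative induction over the non-zero integers all of whose odd prime factors lie in
`S`: it suffices to treat `1`, `-1`, `2`, the primes of `S`, and products. [folklore] -/
theorem int_mul_induction {P : ℤ → Prop} (h1 : P 1) (hneg : P (-1)) (h2 : P 2)
    (hprime : ∀ ℓ : ℕ, ℓ ∈ S → P ℓ)
    (hmul : ∀ a b : ℤ, a ≠ 0 → b ≠ 0 → P a → P b → P (a * b)) :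
    ∀ a : ℤ, a ≠ 0 → (∀ q : ℕ, q.Prime → q ≠ 2 → (q : ℤ) ∣ a → q ∈ S) → P a := by
  -- first natural numbers, by strong induction
  have hnat : ∀ n : ℕ, n ≠ 0 → (∀ q : ℕ, q.Prime → q ≠ 2 → q ∣ n → q ∈ S) → P n := by
    intro n
    induction n using Nat.strong_induction_on with
    | _ n ih =>
      intro hn hS
      rcases Nat.lt_or_ge n 2 with hlt | hge
      · interval_cases n
        · exact absurd rfl hn
        · exact_mod_cast h1
      · set q := n.minFac with hq
        have hqp : q.Prime := Nat.minFac_prime (by omega)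
        have hqn : q ∣ n := Nat.minFac_dvd n
        obtain ⟨m, hm⟩ := hqn
        have hm0 : m ≠ 0 := by rintro rfl; simp at hm; exact hn hm
        have hmlt : m < n := by
          rw [hm]; exact lt_mul_left (Nat.pos_of_ne_zero hm0) hqp.one_lt
        have hPq : P q := by
          by_cases hq2 : q = 2
          · rw [hq2]; exact_mod_cast h2
          · exact hprime q (hS q hqp hq2 ⟨m, hm⟩)
        have hPm : P m := ih m hmlt hm0 fun r hr hr2 hrm ↦ hS r hr hr2 (hm ▸ dvd_mul_of_dvd_right hrm q)
        have := hmul q m (by exact_mod_cast hqp.ne_zero) (by exact_mod_cast hm0) hPq hPm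
        rw [hm]; push_cast; exact this
  intro a ha hS
  have hS' : ∀ q : ℕ, q.Prime → q ≠ 2 → q ∣ a.natAbs → q ∈ S :=
    fun q hq hq2 hqa ↦ hS q hq hq2 (Int.natCast_dvd.2 hqa)
  rcases lt_or_gt_of_ne ha with hlt | hgt
  · have : a = -1 * (a.natAbs : ℤ) := by
      rw [Int.natCast_natAbs, abs_of_neg hlt]; ring
    rw [this]
    exact hmul _ _ (by norm_num) (by simpa using ha) hneg
      (hnat a.natAbs (by simpa using ha) hS')
  · have : a = (a.natAbs : ℤ) := by rw [Int.natCast_natAbs, abs_of_pos hgt]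
    rw [this]
    exact hnat a.natAbs (by simpa using ha) hS'

variable (hS : ∀ q ∈ S, q.Prime ∧ q ≠ 2)
include hS

omit hp in
/-- The total sign `F_S(x, b)` is `1` when `x ∈ {-1, 2} ∪ S` is a generator and all odd prime
factors of `b ≠ 0` lie in `S` (multiplicative induction on `b` from the generator table).
[folklore] -/
theorem totalSign_gen_left {x : ℤ} (hx : x = -1 ∨ x = 2 ∨ ∃ ℓ ∈ S, x = ℓ) :
    ∀ b : ℤ, b ≠ 0 → (∀ q : ℕ, q.Prime → q ≠ 2 → (q : ℤ) ∣ b → q ∈ S) → totalSign S x b = 1 := by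
  have hx0 : x ≠ 0 := by
    rcases hx with rfl | rfl | ⟨ℓ, hℓ, rfl⟩
    · norm_num
    · norm_num
    · exact_mod_cast (hS ℓ hℓ).1.ne_zero
  refine int_mul_induction S (totalSign_one_right S x) ?_ ?_ ?_ ?_
  · -- `b = -1`
    rcases hx with rfl | rfl | ⟨ℓ, hℓ, rfl⟩
    · exact totalSign_neg_one_neg_one S hS
    · rw [totalSign_comm]; exact totalSign_neg_one_two S hS
    · rw [totalSign_comm]; exact totalSign_neg_one_prime S hS hℓ
  · -- `b = 2`
    rcases hx with rfl | rfl | ⟨ℓ, hℓ, rfl⟩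
    · exact totalSign_neg_one_two S hS
    · exact totalSign_two_two S hS
    · rw [totalSign_comm]; exact totalSign_two_prime S hS hℓ
  · -- `b = ℓ'`
    intro ℓ' hℓ'
    rcases hx with rfl | rfl | ⟨ℓ, hℓ, rfl⟩
    · exact totalSign_neg_one_prime S hS hℓ'
    · exact totalSign_two_prime S hS hℓ'
    · by_cases h : ℓ = ℓ'
      · subst h; exact totalSign_prime_self S hS hℓ
      · exact totalSign_prime_prime S hS hℓ hℓ' h
  · intro b b' hb hb' h h'
    rw [totalSign_mul_right S hx0 hb hb', h, h', one_mul]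

omit hp in
/-- **Product formula for Serre's explicit local signs** (the arithmetic content of Hilbert's
reciprocity law over `ℚ`; Serre, *A Course in Arithmetic*, Ch. III Thm. 3, with the local values
of Thm. 1): for non-zero integers `a, b` and any finite set `S` of odd primes containing the odd
prime factors of `a b`,
`(a, b)_∞ · (a, b)_2 · ∏_{p ∈ S} (a, b)_p = 1` for the explicit signs `localSignInfty`,
`localSignTwo`, `localSignOdd`. The proof is Serre's: all three signs are symmetric and
bimultiplicative, so one reduces to `a, b ∈ {-1, 2} ∪ S`, where the identity is `(-1,-1)_∞ =
(-1,-1)_2 = -1`, the two supplements `(ℓ, -1)_ℓ = χ₄ ℓ = (-1, ℓ)_2`, `(ℓ, 2)_ℓ = χ₈ ℓ = (2, ℓ)_2`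
and, for distinct odd primes, quadratic reciprocity
`(ℓ / ℓ') (ℓ' / ℓ) = (-1)^{ε(ℓ) ε(ℓ')} = (ℓ, ℓ')_2` (Mathlib `legendreSym.quadratic_reciprocity`,
`legendreSym.at_neg_one`, `legendreSym.at_two`). [cite: Serre1973, Ch. III §2.1 Thm. 3] -/
theorem totalSign_eq_one {a b : ℤ} (ha : a ≠ 0) (hb : b ≠ 0)
    (hSa : ∀ q : ℕ, q.Prime → q ≠ 2 → (q : ℤ) ∣ a → q ∈ S)
    (hSb : ∀ q : ℕ, q.Prime → q ≠ 2 → (q : ℤ) ∣ b → q ∈ S) :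
    totalSign S a b = 1 := by
  refine int_mul_induction S (P := fun a ↦ ∀ b : ℤ, b ≠ 0 →
      (∀ q : ℕ, q.Prime → q ≠ 2 → (q : ℤ) ∣ b → q ∈ S) → totalSign S a b = 1)
    (fun b _ _ ↦ totalSign_one_left S b) ?_ ?_ ?_ ?_ a ha hSa b hb hSb
  · exact totalSign_gen_left S hS (Or.inl rfl)
  · exact totalSign_gen_left S hS (Or.inr (Or.inl rfl))
  · exact fun ℓ hℓ ↦ totalSign_gen_left S hS (Or.inr (Or.inr ⟨ℓ, hℓ, rfl⟩))
  · intro a a' ha ha' h h' b hb hSb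
    rw [totalSign_mul_left S ha ha' hb, h b hb hSb, h' b hb hSb, one_mul]

end Main

end Literature.NumberTheory.QuadraticForms
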